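import Literature.NumberTheory.Automorphic.TwistedAsaiPole
import Literature.NumberTheory.Automorphic.AutomorphicTwistHecke
import Literature.NumberTheory.Automorphic.AsaiSignArchParityTwist
import Literature.NumberTheory.Automorphic.GLOneOfHeckeCharacterBJ
import Literature.NumberTheory.GaloisRepresentations.HeckeCharacterNormTwistProofs
import Literature.NumberTheory.GaloisRepresentations.HeckeLFunctionNonvanishingLineProofs
import HarnessLib

/-!
# Quadratic descent for `GL₂`, line `Sketch` — stub W1: unitary reduction by a norm twist

Helper file for the crux `ParityBlindBianchi.QuadraticDescentGL2` (stmt-Langlands-16811), line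
`Sketch`, stub `stub_unitaryReduction`.

For an Asai datum `(S, A)` of a cuspidal `P` on `GL₂(𝔸_E)`, a Hecke character `χ` of `F`
unramified off `S` and the central clause `e₂(A w) χ(ϖ_v)^{f(w|v)} = 1` above `v ∉ S`: writing
`|χ| = ‖·‖^σ` (`HeckeCharacter.exists_norm_apply_eq_ideleNorm_rpow`, Weil/Tate), put
`ν = ‖·‖_E^{z}` with `z = σ/2` and `ν₀ = ‖·‖_F^{-2z}`
(`HeckeCharacter.exists_forall_apply_eq_ideleNorm_cpow`). Then `χ₁ = χ ν₀` is UNITARY and has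
the ramification of `χ` (norm twists are unramified everywhere,
`HeckeCharacter.IsNormTwist.isUnramifiedAt_holds`), the twist `P₁ = P ⊗ (ν ∘ det)`
(`exists_cuspidalAutomorphicRepData_twist_hecke`) carries the Asai datum `(S, A₁)` with
`A₁ w = ν(ϖ_w) A w = q_w^{-z} A w` (`AutomorphicRepData.HasSatakeParamAt.heckeTwist`), and the
numerics `q_w = q_v^{f(w|v)}` (`residueCard_eq_pow_inertiaDeg`; `f = 2` at a `c`-fixed place of
an Asai datum, `f = 1` at a `c`-moved one, `HeightOneSpectrum.inertiaDeg_eq_one_of_smul_ne`)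
give the same central clause and the same twisted local Asai factors
(`asaiLocalPolynomial_twist_of_smul_eq/_ne`): `P^θ_{A₁}(χ₁(ϖ_v) x) = P^θ_A(χ(ϖ_v) x)` above
`v ∉ S`.

All inputs are theorems of the tree.
-/

set_option linter.dupNamespace false

namespace Summit.Langlands.Langlands.Theorems.QuadraticDescentGL2.Sketch

open scoped Classical
open NumberField IsDedekindDomain Polynomial Filter
open Literature.NumberTheory.Automorphic Literature.NumberTheory.GaloisRepresentations

/-! ### Norm-power characters at uniformizers and the `q`-power bookkeeping -/

/-- `‖·‖^z(ϖ_v) = q_v^{-z}` in the tree's `residueCard` currency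
(`HeckeCharacter.valueAtUniformizer_of_forall_apply_eq_cpow`). [cite: TateThesis1967, §4.3] -/
theorem unitaryReduction_valueAtUniformizer_normPow {K : Type} [Field K] [NumberField K]
    {ν : HeckeCharacter K} {z : ℂ}
    (hν : ∀ x : ideleGroup K, ((ν x : ℂˣ) : ℂ) = ((ideleNorm x : ℝ) : ℂ) ^ z)
    (v : HeightOneSpectrum (𝓞 K)) :
    ν.valueAtUniformizer v = ((v.residueCard : ℕ) : ℂ) ^ (-z) :=
  HeckeCharacter.valueAtUniformizer_of_forall_apply_eq_cpow hν v

/-- Inert bookkeeping: `(q²)^{-z} · q^{2z} = 1`. [folklore] -/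
theorem unitaryReduction_numerics_inert (q : ℕ) (hq : q ≠ 0) (z : ℂ) :
    ((q ^ 2 : ℕ) : ℂ) ^ (-z) * (q : ℂ) ^ (-(-(z + z))) = 1 := by
  have hq' : (q : ℂ) ≠ 0 := Nat.cast_ne_zero.mpr hq
  rw [Nat.cast_pow, ← Complex.natCast_cpow_natCast_mul, ← Complex.cpow_add _ _ hq']
  have h0 : ((2 : ℕ) : ℂ) * -z + - -(z + z) = 0 := by push_cast; ring
  rw [h0, Complex.cpow_zero]

/-- Split bookkeeping: `q^{-z} · q^{-z} · q^{2z} = 1`. [folklore] -/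
theorem unitaryReduction_numerics_split (q : ℕ) (hq : q ≠ 0) (z : ℂ) :
    (q : ℂ) ^ (-z) * (q : ℂ) ^ (-z) * (q : ℂ) ^ (-(-(z + z))) = 1 := by
  have hq' : (q : ℂ) ≠ 0 := Nat.cast_ne_zero.mpr hq
  rw [← Complex.cpow_add _ _ hq', ← Complex.cpow_add _ _ hq']
  have h0 : -z + -z + - -(z + z) = 0 := by ring
  rw [h0, Complex.cpow_zero]

/-- Central bookkeeping: `((q^f)^{-z})² · (q^{2z})^f = 1`. [folklore] -/
theorem unitaryReduction_numerics_central (q f : ℕ) (hq : q ≠ 0) (z : ℂ) :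
    (((q ^ f : ℕ) : ℂ) ^ (-z)) ^ 2 * ((q : ℂ) ^ (-(-(z + z)))) ^ f = 1 := by
  have hq' : (q : ℂ) ≠ 0 := Nat.cast_ne_zero.mpr hq
  rw [Nat.cast_pow, ← Complex.natCast_cpow_natCast_mul, ← Complex.cpow_nat_mul,
    ← Complex.cpow_nat_mul, ← Complex.cpow_add _ _ hq']
  have h0 : ((2 : ℕ) : ℂ) * ((f : ℂ) * -z) + (f : ℂ) * - -(z + z) = 0 := by push_cast; ring
  rw [h0, Complex.cpow_zero]

/-! ### The stub -/

/-- **Stub W1 (unitary reduction by a norm twist).** For an Asai datum `(S, A)` of a cuspidal `P`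
on `GL₂(𝔸_E)`, a Hecke character `χ` of `F` unramified off `S` and the central clause
`e₂(A w) χ(ϖ_v)^{f(w|v)} = 1` above `v ∉ S`: writing `|χ| = ‖·‖^σ`
(`HeckeCharacter.exists_norm_apply_eq_ideleNorm_rpow`), the pair
`(P₁, χ₁) = (P ⊗ ‖det‖_E^{σ/2}, χ ‖·‖_F^{-σ})` has `χ₁` UNITARY, the Asai datum `(S, A₁)`,
`A₁ w = ‖ϖ_w‖^{σ/2} A w = q_w^{-σ/2} A w`, the same ramification, the same central clause, and the
same twisted local Asai factors: `P^θ_{A₁}(χ₁(ϖ_v) x) = P^θ_A(χ(ϖ_v) x)` above `v ∉ S`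
(`q_w = q_v^{f(w|v)}`; the twist calculus `asaiLocalPolynomial_twist_of_smul_eq/_ne`). The
hypothesis `c ≠ 1` is not used. [folklore] -/
theorem stub_unitaryReduction :
    ∀ (F E : Type) [Field F] [NumberField F] [Field E] [NumberField E] [Algebra F E] (c : E ≃ₐ[F] E),
      Module.finrank F E = 2 → c ≠ 1 →
      ∀ (hE : isCompact_glFiniteIntegralLevel 2 E) (P : CuspidalAutomorphicRepData 2 E hE)
        (χ : HeckeCharacter F) (S : Set (HeightOneSpectrum (𝓞 F))) (A : SatakeFamily E),
        P.1.IsAsaiDatum c S A → χ.ramifiedPlaces ⊆ S →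
        (∀ w : HeightOneSpectrum (𝓞 E), w.under (𝓞 F) ∉ S →
          (A w).prod * χ.valueAtUniformizer (w.under (𝓞 F)) ^ w.asIdeal.inertiaDeg (𝓞 F) = 1) →
        ∃ (P₁ : CuspidalAutomorphicRepData 2 E hE) (χ₁ : HeckeCharacter F) (A₁ : SatakeFamily E),
          χ₁.IsUnitary ∧ P₁.1.IsAsaiDatum c S A₁ ∧ χ₁.ramifiedPlaces ⊆ S ∧
          (∀ w : HeightOneSpectrum (𝓞 E), w.under (𝓞 F) ∉ S →
            (A₁ w).prod * χ₁.valueAtUniformizer (w.under (𝓞 F)) ^ w.asIdeal.inertiaDeg (𝓞 F) = 1) ∧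
          ∀ (θ : ℤˣ) (v : HeightOneSpectrum (𝓞 F)), v ∉ S → ∀ x : ℂ,
            (asaiLocalPolynomial c A₁ θ (placeAbove E v)).eval (χ₁.valueAtUniformizer v * x) =
              (asaiLocalPolynomial c A θ (placeAbove E v)).eval (χ.valueAtUniformizer v * x) := by
  intro F E _ _ _ _ _ c h2 _hc hE P χ S A hSA hram hcent
  haveI : NeZero (2 : ℕ) := ⟨two_ne_zero⟩
  -- `|χ| = ‖·‖^σ`
  obtain ⟨σ, hσ⟩ := χ.exists_norm_apply_eq_ideleNorm_rpow
  set z : ℂ := ((σ / 2 : ℝ) : ℂ) with hz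
  -- the norm-power characters `ν = ‖·‖_E^z`, `ν₀ = ‖·‖_F^{-2z}`
  obtain ⟨ν, hν⟩ := HeckeCharacter.exists_forall_apply_eq_ideleNorm_cpow E z
  obtain ⟨ν₀, hν₀⟩ := HeckeCharacter.exists_forall_apply_eq_ideleNorm_cpow F (-(z + z))
  have hνunr : ∀ w : HeightOneSpectrum (𝓞 E), ν.IsUnramifiedAt w := fun w =>
    HeckeCharacter.IsNormTwist.isUnramifiedAt_holds ⟨z, hν⟩ w
  -- the twist `P₁ = P ⊗ (ν ∘ det)`
  obtain ⟨P₁, hW, hW'⟩ := exists_cuspidalAutomorphicRepData_twist_hecke ν P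
  refine ⟨P₁, χ * ν₀, fun w => (A w).map (ν.valueAtUniformizer w * ·), ?_, ?_, ?_, ?_, ?_⟩
  · -- `χ₁` is unitary: `‖χ x‖ ‖ν₀ x‖ = ‖x‖^σ ‖x‖^{-σ} = 1`
    intro x
    rw [HeckeCharacter.mul_apply, Units.val_mul, norm_mul, hσ x,
      HeckeCharacter.norm_apply_of_forall_apply_eq_cpow hν₀ x,
      ← Real.rpow_add (HeckeCharacter.ideleNorm_pos' F x)]
    have h0 : σ + (-(z + z)).re = 0 := by
      rw [hz, Complex.neg_re, Complex.add_re, Complex.ofReal_re]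
      ring
    rw [h0, Real.rpow_zero]
  · -- the Asai datum `(S, ν(ϖ) • A)` of the twist (`ν` is unramified everywhere)
    exact ⟨hSA.finite, fun w hw => (hSA.hasSatakeParamAt hw).heckeTwist ν (hνunr w) hW hW',
      fun w hw hcw => hSA.inertiaDeg_eq_two hw hcw⟩
  · -- ramification of `χ₁ = χ ν₀` is that of `χ`
    intro v hv
    exact hram fun h =>
      hv ((HeckeCharacter.isUnramifiedAt_mul_iff_of_forall_apply_eq_cpow χ hν₀ v).mpr h)
  · -- the central clause: `e₂(A₁ w) χ₁(ϖ_v)^f = (q_w^{-2z} q_v^{2zf}) · e₂(A w) χ(ϖ_v)^f = 1`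
    intro w hw
    dsimp only
    have hcard : Multiset.card (A w) = 2 := (hSA.hasSatakeParamAt hw).card_eq
    have hq : (w.under (𝓞 F)).residueCard ≠ 0 := by
      have := (w.under (𝓞 F)).one_lt_residueCard
      omega
    have hnum : ν.valueAtUniformizer w ^ 2 *
        ν₀.valueAtUniformizer (w.under (𝓞 F)) ^ w.asIdeal.inertiaDeg (𝓞 F) = 1 := by
      rw [unitaryReduction_valueAtUniformizer_normPow hν w,
        unitaryReduction_valueAtUniformizer_normPow hν₀ (w.under (𝓞 F)),
        residueCard_eq_pow_inertiaDeg (F := F) w]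
      exact unitaryReduction_numerics_central _ _ hq z
    rw [Multiset.prod_map_mul, Multiset.map_const', Multiset.prod_replicate, Multiset.map_id',
      hcard, HeckeCharacter.valueAtUniformizer_mul, mul_pow]
    linear_combination
      ((A w).prod * χ.valueAtUniformizer (w.under (𝓞 F)) ^ w.asIdeal.inertiaDeg (𝓞 F)) * hnum +
        hcent w hw
  · -- the twisted local Asai factors above `v ∉ S`
    intro θ v hv x
    set w₀ := placeAbove E v with hw₀
    have hw₀v : w₀.under (𝓞 F) = v := placeAbove_under v
    have hw₀S : w₀.under (𝓞 F) ∉ S := by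
      rw [hw₀v]
      exact hv
    have hq : v.residueCard ≠ 0 := by
      have := v.one_lt_residueCard
      omega
    rw [HeckeCharacter.valueAtUniformizer_mul]
    by_cases hfix : c • w₀ = w₀
    · -- inert: `q_{w₀} = q_v²`, `ν(ϖ_{w₀}) ν₀(ϖ_v) = q_v^{-2z} q_v^{2z} = 1`
      have hqw := residueCard_eq_pow_inertiaDeg (F := F) w₀
      rw [hSA.inertiaDeg_eq_two hw₀S hfix, hw₀v] at hqw
      have hnum : ν.valueAtUniformizer w₀ * ν₀.valueAtUniformizer v = 1 := by
        rw [unitaryReduction_valueAtUniformizer_normPow hν w₀,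
          unitaryReduction_valueAtUniformizer_normPow hν₀ v, hqw]
        exact unitaryReduction_numerics_inert _ hq z
      rw [asaiLocalPolynomial_twist_of_smul_eq A ν.valueAtUniformizer θ hfix, eval_comp, eval_mul,
        eval_C, eval_X]
      congr 1
      linear_combination (χ.valueAtUniformizer v * x) * hnum
    · -- split: `q_{w₀} = q_{c • w₀} = q_v`, `ν(ϖ_{w₀}) ν(ϖ_{c w₀}) ν₀(ϖ_v) = q_v^{-z} q_v^{-z} q_v^{2z} = 1`
      have hq₀ := residueCard_eq_pow_inertiaDeg (F := F) w₀
      rw [HeightOneSpectrum.inertiaDeg_eq_one_of_smul_ne h2 hfix, pow_one, hw₀v] at hq₀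
      have hq₁ : (c • w₀).residueCard = v.residueCard := by
        rw [residueCard_smul F c w₀, hq₀]
      have hnum : ν.valueAtUniformizer w₀ * ν.valueAtUniformizer (c • w₀) *
          ν₀.valueAtUniformizer v = 1 := by
        rw [unitaryReduction_valueAtUniformizer_normPow hν w₀,
          unitaryReduction_valueAtUniformizer_normPow hν (c • w₀),
          unitaryReduction_valueAtUniformizer_normPow hν₀ v, hq₀, hq₁]
        exact unitaryReduction_numerics_split _ hq z
      rw [asaiLocalPolynomial_twist_of_smul_ne A ν.valueAtUniformizer θ hfix, eval_comp, eval_mul,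
        eval_C, eval_X]
      congr 1
      linear_combination (χ.valueAtUniformizer v * x) * hnum

end Summit.Langlands.Langlands.Theorems.QuadraticDescentGL2.Sketch
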